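import Mathlib
import Summits.AtomisticToContinuum.HydrodynamicLimit.Theorems.InformationPercolationEngineKickFairRelEquilibriumMesoShortFlightRung0
import HarnessLib

/-!
# `KickFairRelEquilibriumMeso`, line `Sketch` — stub U (`stub_shortFlightLG`): the EVOLVED-LAW window-flux
# inequality (the Campbell–Fatou device WITHOUT invariance)

Helper file (`--supports stmt-AtomisticToContinuum-15177`) for the registered stub `stub_shortFlightLG` (U: the
`LG`-mean of the normalised number of short-flight collisions is `≤ δ`). The rung-0 proof (`shortFlightLG_rung0`,
constant profiles) uses the invariance of the homogeneous Gibbs law in exactly ONE place: the abstract mean device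
`Literature.MathematicalPhysics.KineticTheory.lintegral_le_liminf_of_le_collisionSum` (pathwise grid bound below the
gap of the collision times, Fatou, STATIONARITY `∫ W_M ∘ Φ_{kh} dP = ∫ W_M dP`), through which both the pair engine
`localGibbsLaw_lintegral_le_of_le_collisionMarkSum` and the forward-contact engine
`localGibbsLaw_lintegral_le_of_le_fwdHitCollisionSum` pass. For the NON-invariant local Gibbs law
`LG = localGibbsLaw σ a₀ u₀ θ₀ N Φ` of continuous profiles the first two steps survive verbatim and give the
**evolved-law window-flux inequality** `lintegral_le_liminf_sum_lintegral_of_le_collisionSum`: for ANY law `P`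
carried by the good set (no invariance), every `f ≥ 0` dominated on the good set by a collision sum
`Σ_{collision times s ∈ [0,τ]} Σ_{ordered contact pairs (i,j)} F(Φ_s z, i, j)` has

  `∫ f dP ≤ liminf_M Σ_{k=1}^{M} ∫ W_M (Φ_{kτ/M} z) dP(z)`,

`W_M = Σ_{i≠j} 𝟙_{E_M(i,j)} F̃_M(·,i,j)` the one-window functional (window events containing every configuration whose
pair reaches contact under a backward free flight of duration `≤ τ/M`, measurable majorants of the mark). The
right-hand side is the time-summed one-window contact flux of the EVOLVED laws `(Φ_{kτ/M})_* P`; under an invariant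
law it is `M ∫ W_M dP` and the Literature statement is recovered (`sum_lintegral_window_flow_eq_of_measurePreserving`).
This isolates the open content of U as an `LG`-native bound on that evolved flux (registered sub-goal
`collisionSum_lintegral_le_evolvedWindowFlux`, binder-free form; specialised corollary for the local Gibbs laws
`localGibbsLaw_lintegral_le_evolvedWindowFlux`: the bad set is null for every profile). The `LG`-side plumbing of the
stub is recorded measure-generically as well: `lintegral_shortFlag_le_mul_lintegral_shortFlightCount` (any law carried
by the good set: the stub's integrand is dominated in the mean by `c ·` the short-flight count of `ShortFlightCharging`,
`sum_shortFlag_le_collisionPairSum`) and `localGibbsLaw_lintegral_shortFlag_le`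
(`E_LG[W_sf(A)] ≤ (ε/(N+1)) · E_LG[𝟙_good · #short(t_N/A)]` for arbitrary profiles), so that U is reduced to an
`LG`-mean bound for the short-flight count, i.e. (pathwise charging `shortFlightCount_le_chargedSums` + the inequality
above) to the evolved window flux of the three charged terms.

References: C. Cercignani, R. Illner, M. Pulvirenti, *The Mathematical Theory of Dilute Gases* (1994), App. 4.A;
I. Gallagher, L. Saint-Raymond, B. Texier, *From Newton to Boltzmann* (2013), Prop. 4.1.1.
-/

noncomputable section

open MeasureTheory Set Filter Topology
open scoped ENNReal InnerProductSpace BigOperators Classical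

namespace Summit.AtomisticToContinuum.HydrodynamicLimit.Theorems.KickFairRelEquilibriumMesoLine

open Literature.Analysis.FluidPDE Literature.Analysis.FunctionSpaces Literature.MathematicalPhysics.KineticTheory

variable {σ : ℝ} {N : ℕ}

/-- **The evolved-law window-flux inequality (Campbell–Fatou without invariance).** For a hard-sphere flow
`Φ` of `N + 1` spheres on `𝕋³`, ANY law `P` carried by the good set (`hP`; no invariance is assumed), `τ > 0`, a
mark `F ≥ 0`, measurable window events `E M i j ⊇ {(i,j) reaches contact under a backward free flight of duration
≤ τ/M}` and measurable majorants `Ft M ≥ F` along those flights, every `f ≥ 0` dominated on the good set by the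
collision sum `Σ_{collision times s ∈ [0,τ]} Σ_{ordered contact pairs (i,j)} F(Φ_s z, i, j)` satisfies
`∫ f dP ≤ liminf_M Σ_{k=1}^{M} ∫ Σ_{i≠j} 𝟙_{E M i j}(Φ_{kτ/M} z) F̃ M (Φ_{kτ/M} z, i, j) dP(z)` — pathwise grid bound
`sum_collision_le_sum_window` once `τ/M` is below the gap of the collision times (`exists_gap_of_finite`), then
Fatou (`lintegral_liminf_le`); the mean of each grid sum is the sum of the means of the window functional under
the evolved laws. No measurability of `f` or of the collision sum is needed. [folklore] -/
theorem lintegral_le_liminf_sum_lintegral_of_le_collisionSum (Φ : Flow σ N) (P : Measure (Phase N))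
    (hP : P Φ.goodᶜ = 0) {τ : ℝ} (hτ : 0 < τ) (F : Phase N → Fin (N + 1) → Fin (N + 1) → ℝ≥0∞)
    (E : ℕ → Fin (N + 1) → Fin (N + 1) → Set (Phase N)) (hEm : ∀ M i j, MeasurableSet (E M i j))
    (hE : ∀ (M : ℕ) (i j : Fin (N + 1)), i ≠ j →
      ∀ w ∈ hardSphereDomain (Torus.geometry (Fin 3)) (N + 1) (hsDiameter σ N), ∀ t ∈ Icc 0 (τ / M),
      ‖(Torus.geometry (Fin 3)).sepVec ((freeFlight (Torus.geometry (Fin 3)) (-t) w i).1)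
        ((freeFlight (Torus.geometry (Fin 3)) (-t) w j).1)‖ = hsDiameter σ N → w ∈ E M i j)
    (Ft : ℕ → Phase N → Fin (N + 1) → Fin (N + 1) → ℝ≥0∞) (hFtm : ∀ M i j, Measurable fun w => Ft M w i j)
    (hFt : ∀ (M : ℕ) (i j : Fin (N + 1)), i ≠ j →
      ∀ w ∈ hardSphereDomain (Torus.geometry (Fin 3)) (N + 1) (hsDiameter σ N), ∀ t ∈ Icc 0 (τ / M),
      ‖(Torus.geometry (Fin 3)).sepVec ((freeFlight (Torus.geometry (Fin 3)) (-t) w i).1)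
        ((freeFlight (Torus.geometry (Fin 3)) (-t) w j).1)‖ = hsDiameter σ N →
        F (freeFlight (Torus.geometry (Fin 3)) (-t) w) i j ≤ Ft M w i j)
    (f : Phase N → ℝ≥0∞)
    (hf : ∀ z ∈ Φ.good, f z ≤ ∑ᶠ s ∈ collisionTimes (Torus.geometry (Fin 3)) (hsDiameter σ N)
        (fun t => Φ.flow t z) ∩ Icc 0 τ,
      ∑ i, ∑ j, (if i ≠ j ∧ ‖(Torus.geometry (Fin 3)).sepVec (Φ.flow s z i).1 (Φ.flow s z j).1‖ = hsDiameter σ N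
        then F (Φ.flow s z) i j else 0)) :
    ∫⁻ z, f z ∂P ≤
      liminf (fun M : ℕ => ∑ k ∈ Finset.Icc 1 M,
        ∫⁻ z, (∑ i, ∑ j, (if i ≠ j then (E M i j).indicator (fun w => Ft M w i j) (Φ.flow ((k : ℝ) * (τ / M)) z)
          else 0)) ∂P) atTop := by
  classical
  -- adapted from `lintegral_le_liminf_of_le_collisionSum` (`CollisionFluxMeanBound`): steps (i) and (iii),
  -- the stationarity step (ii) replaced by additivity of the mean over the grid
  set W : ℕ → Phase N → ℝ≥0∞ := fun M w => ∑ i, ∑ j,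
    (if i ≠ j then (E M i j).indicator (fun w => Ft M w i j) w else 0) with hWdef
  have hWm : ∀ M, Measurable (W M) := by
    intro M
    refine Finset.measurable_sum _ fun i _ => Finset.measurable_sum _ fun j _ => ?_
    by_cases hij : i ≠ j
    · simp only [if_pos hij]
      exact (hFtm M i j).indicator (hEm M i j)
    · simp only [if_neg hij]
      exact measurable_const
  set SM : ℕ → Phase N → ℝ≥0∞ := fun M z =>
    ∑ k ∈ Finset.Icc 1 M, W M (Φ.flow ((k : ℝ) * (τ / M)) z) with hSMdef
  have hSMm : ∀ M, Measurable (SM M) := fun M =>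
    Finset.measurable_sum _ fun k _ => (hWm M).comp (Φ.measurable_flow _)
  set Kstar : Phase N → ℝ≥0∞ := fun z => liminf (fun M => SM M z) atTop with hKdef
  -- (i) the pathwise bound on the good set, hence `f ≤ Kstar` almost everywhere
  have hpath : ∀ z ∈ Φ.good, f z ≤ Kstar z := by
    intro z hz
    refine (hf z hz).trans ?_
    have hγ := Φ.isTrajectory z hz
    have hfin := hγ.locFinite 0 τ
    rw [finsum_mem_eq_finite_toFinset_sum _ hfin]
    obtain ⟨g, hg, hgap⟩ := exists_gap_of_finite hfin
    show _ ≤ liminf (fun M => SM M z) atTop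
    refine le_liminf_of_le (h := ?_)
    filter_upwards [eventually_gt_atTop ⌈τ / g⌉₊] with M hM
    have hM0 : 0 < M := lt_of_le_of_lt (Nat.zero_le _) hM
    have hMg : τ / M < g := by
      have h1 : τ / g < M := (Nat.le_ceil _).trans_lt (by exact_mod_cast hM)
      rw [div_lt_iff₀ hg] at h1
      rw [div_lt_iff₀ (by exact_mod_cast hM0)]
      linarith
    have hgap' : ∀ s ∈ collisionTimes (Torus.geometry (Fin 3)) (hsDiameter σ N) (fun t => Φ.flow t z) ∩ Icc 0 τ,
        ∀ s' ∈ collisionTimes (Torus.geometry (Fin 3)) (hsDiameter σ N) (fun t => Φ.flow t z) ∩ Icc 0 τ,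
          s < s' → τ / M < s' - s :=
      fun s hs s' hs' hlt => hMg.trans_le (hgap s hs s' hs' hlt)
    exact sum_collision_le_sum_window hγ hτ hM0 hgap' (E M) (hE M) F (Ft M) (hFt M)
  have hae : ∀ᵐ z ∂P, f z ≤ Kstar z := by
    have h : ∀ᵐ z ∂P, z ∈ Φ.good := by
      rw [ae_iff]
      exact hP
    filter_upwards [h] with z hz using hpath z hz
  -- (ii') the mean of each grid sum is the sum of the evolved means (no invariance)
  have hmeanM : ∀ M, ∫⁻ z, SM M z ∂P =
      ∑ k ∈ Finset.Icc 1 M, ∫⁻ z, W M (Φ.flow ((k : ℝ) * (τ / M)) z) ∂P := fun M =>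
    lintegral_finsetSum _ fun k _ => (hWm M).comp (Φ.measurable_flow _)
  -- (iii) Fatou
  calc ∫⁻ z, f z ∂P ≤ ∫⁻ z, Kstar z ∂P := lintegral_mono_ae hae
    _ ≤ liminf (fun M : ℕ => ∫⁻ z, SM M z ∂P) atTop := lintegral_liminf_le hSMm
    _ = liminf (fun M : ℕ => ∑ k ∈ Finset.Icc 1 M,
          ∫⁻ z, W M (Φ.flow ((k : ℝ) * (τ / M)) z) ∂P) atTop :=
        congrArg (fun u : ℕ → ℝ≥0∞ => liminf u atTop) (funext hmeanM)

/-- **The invariant case is recovered.** Under a law preserved by every `Φ_t`, each evolved mean equals the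
time-zero mean and the right-hand side of `lintegral_le_liminf_sum_lintegral_of_le_collisionSum` is
`liminf_M M ∫ W_M dP`, the bound of `lintegral_le_liminf_of_le_collisionSum`. [folklore] -/
theorem sum_lintegral_window_flow_eq_of_measurePreserving (Φ : Flow σ N) (P : Measure (Phase N))
    (hstat : ∀ t : ℝ, MeasurePreserving (Φ.flow t) P P) (τ : ℝ)
    (E : ℕ → Fin (N + 1) → Fin (N + 1) → Set (Phase N)) (hEm : ∀ M i j, MeasurableSet (E M i j))
    (Ft : ℕ → Phase N → Fin (N + 1) → Fin (N + 1) → ℝ≥0∞) (hFtm : ∀ M i j, Measurable fun w => Ft M w i j)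
    (M : ℕ) :
    ∑ k ∈ Finset.Icc 1 M,
        ∫⁻ z, (∑ i, ∑ j, (if i ≠ j then (E M i j).indicator (fun w => Ft M w i j) (Φ.flow ((k : ℝ) * (τ / M)) z)
          else 0)) ∂P =
      (M : ℝ≥0∞) * ∫⁻ w, ∑ i, ∑ j, (if i ≠ j then (E M i j).indicator (fun w => Ft M w i j) w else 0) ∂P := by
  classical
  set W : Phase N → ℝ≥0∞ := fun w => ∑ i, ∑ j,
    (if i ≠ j then (E M i j).indicator (fun w => Ft M w i j) w else 0) with hWdef
  have hWm : Measurable W := by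
    refine Finset.measurable_sum _ fun i _ => Finset.measurable_sum _ fun j _ => ?_
    by_cases hij : i ≠ j
    · simp only [if_pos hij]
      exact (hFtm M i j).indicator (hEm M i j)
    · simp only [if_neg hij]
      exact measurable_const
  calc ∑ k ∈ Finset.Icc 1 M, ∫⁻ z, W (Φ.flow ((k : ℝ) * (τ / M)) z) ∂P
      = ∑ _k ∈ Finset.Icc 1 M, ∫⁻ z, W z ∂P :=
        Finset.sum_congr rfl fun k _ => (hstat _).lintegral_comp hWm
    _ = (M : ℝ≥0∞) * ∫⁻ w, W w ∂P := by
        rw [Finset.sum_const, Nat.card_Icc, Nat.add_sub_cancel, nsmul_eq_mul]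

/-- **Registered sub-goal `collisionSum_lintegral_le_evolvedWindowFlux`** (binder-free form of
`lintegral_le_liminf_sum_lintegral_of_le_collisionSum`): for every flow, every law carried by the good set, every
horizon `τ > 0`, mark, admissible measurable window events and majorants, every `f ≥ 0` dominated on the good set
by the collision sum has mean at most the `liminf` over the mesh of the time-summed evolved one-window flux.
[folklore] -/
theorem collisionSum_lintegral_le_evolvedWindowFlux :
    ∀ (σ : ℝ) (N : ℕ) (Φ : Flow σ N) (P : Measure (Phase N)), P Φ.goodᶜ = 0 → ∀ τ : ℝ, 0 < τ →
    ∀ (F : Phase N → Fin (N + 1) → Fin (N + 1) → ℝ≥0∞) (E : ℕ → Fin (N + 1) → Fin (N + 1) → Set (Phase N)),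
    (∀ M i j, MeasurableSet (E M i j)) →
    (∀ (M : ℕ) (i j : Fin (N + 1)), i ≠ j →
      ∀ w ∈ hardSphereDomain (Torus.geometry (Fin 3)) (N + 1) (hsDiameter σ N), ∀ t ∈ Icc 0 (τ / M),
      ‖(Torus.geometry (Fin 3)).sepVec ((freeFlight (Torus.geometry (Fin 3)) (-t) w i).1)
        ((freeFlight (Torus.geometry (Fin 3)) (-t) w j).1)‖ = hsDiameter σ N → w ∈ E M i j) →
    ∀ (Ft : ℕ → Phase N → Fin (N + 1) → Fin (N + 1) → ℝ≥0∞), (∀ M i j, Measurable fun w => Ft M w i j) →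
    (∀ (M : ℕ) (i j : Fin (N + 1)), i ≠ j →
      ∀ w ∈ hardSphereDomain (Torus.geometry (Fin 3)) (N + 1) (hsDiameter σ N), ∀ t ∈ Icc 0 (τ / M),
      ‖(Torus.geometry (Fin 3)).sepVec ((freeFlight (Torus.geometry (Fin 3)) (-t) w i).1)
        ((freeFlight (Torus.geometry (Fin 3)) (-t) w j).1)‖ = hsDiameter σ N →
        F (freeFlight (Torus.geometry (Fin 3)) (-t) w) i j ≤ Ft M w i j) →
    ∀ (f : Phase N → ℝ≥0∞),
    (∀ z ∈ Φ.good, f z ≤ ∑ᶠ s ∈ collisionTimes (Torus.geometry (Fin 3)) (hsDiameter σ N)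
        (fun t => Φ.flow t z) ∩ Icc 0 τ,
      ∑ i, ∑ j, (if i ≠ j ∧ ‖(Torus.geometry (Fin 3)).sepVec (Φ.flow s z i).1 (Φ.flow s z j).1‖ = hsDiameter σ N
        then F (Φ.flow s z) i j else 0)) →
    ∫⁻ z, f z ∂P ≤
      liminf (fun M : ℕ => ∑ k ∈ Finset.Icc 1 M,
        ∫⁻ z, (∑ i, ∑ j, (if i ≠ j then (E M i j).indicator (fun w => Ft M w i j) (Φ.flow ((k : ℝ) * (τ / M)) z)
          else 0)) ∂P) atTop :=
  fun _ _ Φ P hP _ hτ F E hEm hE Ft hFtm hFt f hf =>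
    lintegral_le_liminf_sum_lintegral_of_le_collisionSum Φ P hP hτ F E hEm hE Ft hFtm hFt f hf

/-- **The evolved-law window-flux inequality for the local Gibbs laws** (arbitrary profiles `a₀, u₀, θ₀`; the
bad set is null for every profile, `≪` Liouville): the `LG`-mean of every `f ≥ 0` dominated on the good set by a
collision sum over `[0, τ]` is at most `liminf_M Σ_{k=1}^{M} ∫ W_M (Φ_{kτ/M} z) dLG(z)` — the time-summed
one-window contact flux of the evolved local Gibbs laws, the quantity an `LG`-native proof of U must bound.
[folklore] -/
theorem localGibbsLaw_lintegral_le_evolvedWindowFlux (a₀ θ₀ : T3 → ℝ) (u₀ : T3 → V3) (Φ : Flow σ N)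
    {τ : ℝ} (hτ : 0 < τ) (F : Phase N → Fin (N + 1) → Fin (N + 1) → ℝ≥0∞)
    (E : ℕ → Fin (N + 1) → Fin (N + 1) → Set (Phase N)) (hEm : ∀ M i j, MeasurableSet (E M i j))
    (hE : ∀ (M : ℕ) (i j : Fin (N + 1)), i ≠ j →
      ∀ w ∈ hardSphereDomain (Torus.geometry (Fin 3)) (N + 1) (hsDiameter σ N), ∀ t ∈ Icc 0 (τ / M),
      ‖(Torus.geometry (Fin 3)).sepVec ((freeFlight (Torus.geometry (Fin 3)) (-t) w i).1)
        ((freeFlight (Torus.geometry (Fin 3)) (-t) w j).1)‖ = hsDiameter σ N → w ∈ E M i j)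
    (Ft : ℕ → Phase N → Fin (N + 1) → Fin (N + 1) → ℝ≥0∞) (hFtm : ∀ M i j, Measurable fun w => Ft M w i j)
    (hFt : ∀ (M : ℕ) (i j : Fin (N + 1)), i ≠ j →
      ∀ w ∈ hardSphereDomain (Torus.geometry (Fin 3)) (N + 1) (hsDiameter σ N), ∀ t ∈ Icc 0 (τ / M),
      ‖(Torus.geometry (Fin 3)).sepVec ((freeFlight (Torus.geometry (Fin 3)) (-t) w i).1)
        ((freeFlight (Torus.geometry (Fin 3)) (-t) w j).1)‖ = hsDiameter σ N →
        F (freeFlight (Torus.geometry (Fin 3)) (-t) w) i j ≤ Ft M w i j)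
    (f : Phase N → ℝ≥0∞)
    (hf : ∀ z ∈ Φ.good, f z ≤ ∑ᶠ s ∈ collisionTimes (Torus.geometry (Fin 3)) (hsDiameter σ N)
        (fun t => Φ.flow t z) ∩ Icc 0 τ,
      ∑ i, ∑ j, (if i ≠ j ∧ ‖(Torus.geometry (Fin 3)).sepVec (Φ.flow s z i).1 (Φ.flow s z j).1‖ = hsDiameter σ N
        then F (Φ.flow s z) i j else 0)) :
    ∫⁻ z, f z ∂(localGibbsLaw σ a₀ u₀ θ₀ N Φ) ≤
      liminf (fun M : ℕ => ∑ k ∈ Finset.Icc 1 M,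
        ∫⁻ z, (∑ i, ∑ j, (if i ≠ j then (E M i j).indicator (fun w => Ft M w i j) (Φ.flow ((k : ℝ) * (τ / M)) z)
          else 0)) ∂(localGibbsLaw σ a₀ u₀ θ₀ N Φ)) atTop :=
  lintegral_le_liminf_sum_lintegral_of_le_collisionSum Φ _ (by
    rw [localGibbsLaw_eq]
    exact localGibbsMeasure_absolutelyContinuous σ _ _ _ N Φ Φ.measure_compl_good) hτ F E hEm hE Ft hFtm hFt f hf

/-! ## The `LG`-side plumbing of U: from the stub's integrand to the short-flight count, under any law carried
by the good set -/

/-- **Pathwise-to-mean plumbing of U under ANY law carried by the good set.** For a flow with `ε < 1/2`, a law `P`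
with `P(goodᶜ) = 0`, a horizon `τ`, a threshold `Δ`, a mesh `r` of the typed past and a constant `c ≥ 0`: the
`P`-mean of `c · Σ_i #{n < cnt_i(τ) : t_{i,n} − s_{i,n} < Δ}` (the stub's integrand, times read off the typed past) is
at most `c ·` the `P`-mean of the short-flight count `Σ_{collisions (s,i,j), s ∈ [0,τ]} 𝟙{s − Δ < pairFlightStart(i,j,s)}`
cut to the good set (`sum_shortFlag_le_collisionPairSum`, `past_time_eq`; the step the rung-0 proof performs under the
invariant law, here measure-generic — in particular for the non-invariant local Gibbs law). [folklore] -/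
theorem lintegral_shortFlag_le_mul_lintegral_shortFlightCount (Φ : Flow σ N) (hε2 : hsDiameter σ N < 1 / 2)
    (P : Measure (Phase N)) (hP : P Φ.goodᶜ = 0) (τ Δ r : ℝ) {c : ℝ} (hc : 0 ≤ c) :
    ∫⁻ z, ENNReal.ofReal (c *
        ∑ i : Fin (N + 1), ∑ n ∈ Finset.range (cnt Φ τ z i),
          (if (past Φ r z i n).2.2.2 - (past Φ r z i n).2.1 < Δ then (1 : ℝ) else 0)) ∂P ≤
      ENNReal.ofReal c * ∫⁻ z, Φ.good.indicator (fun z => ENNReal.ofReal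
        (collisionPairSum (Torus.geometry (Fin 3)) (hsDiameter σ N) (orbit σ N Φ z) (Icc 0 τ)
          (fun s i j => if s - Δ < pairFlightStart σ N Φ z i j s then (1 : ℝ) else 0))) z ∂P := by
  classical
  -- adapted from the `hdom`/`calc` steps of `shortFlightLG_rung0` (…MesoShortFlightRung0), measure-generic
  have hdom : ∀ z ∈ Φ.good, ENNReal.ofReal (c *
      ∑ i : Fin (N + 1), ∑ n ∈ Finset.range (cnt Φ τ z i),
        (if (past Φ r z i n).2.2.2 - (past Φ r z i n).2.1 < Δ then (1 : ℝ) else 0)) ≤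
      ENNReal.ofReal c * Φ.good.indicator (fun z => ENNReal.ofReal
        (collisionPairSum (Torus.geometry (Fin 3)) (hsDiameter σ N) (orbit σ N Φ z) (Icc 0 τ)
          (fun s i j => if s - Δ < pairFlightStart σ N Φ z i j s then (1 : ℝ) else 0))) z := by
    intro z hz
    rw [indicator_of_mem hz, ← ENNReal.ofReal_mul hc]
    refine ENNReal.ofReal_le_ofReal (mul_le_mul_of_nonneg_left ?_ hc)
    refine Eq.trans_le ?_ (sum_shortFlag_le_collisionPairSum hz hε2 τ Δ)
    refine Finset.sum_congr rfl fun i _ => Finset.sum_congr rfl fun n _ => ?_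
    rw [(past_time_eq hz r i n).1, (past_time_eq hz r i n).2]
  have hae : ∀ᵐ z ∂P, z ∈ Φ.good := by
    rw [ae_iff]
    exact hP
  calc ∫⁻ z, ENNReal.ofReal (c *
        ∑ i : Fin (N + 1), ∑ n ∈ Finset.range (cnt Φ τ z i),
          (if (past Φ r z i n).2.2.2 - (past Φ r z i n).2.1 < Δ then (1 : ℝ) else 0)) ∂P
      ≤ ∫⁻ z, ENNReal.ofReal c * Φ.good.indicator (fun z => ENNReal.ofReal
          (collisionPairSum (Torus.geometry (Fin 3)) (hsDiameter σ N) (orbit σ N Φ z) (Icc 0 τ)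
            (fun s i j => if s - Δ < pairFlightStart σ N Φ z i j s then (1 : ℝ) else 0))) z ∂P :=
        lintegral_mono_ae (by filter_upwards [hae] with z hz using hdom z hz)
    _ = ENNReal.ofReal c * ∫⁻ z, Φ.good.indicator (fun z => ENNReal.ofReal
          (collisionPairSum (Torus.geometry (Fin 3)) (hsDiameter σ N) (orbit σ N Φ z) (Icc 0 τ)
            (fun s i j => if s - Δ < pairFlightStart σ N Φ z i j s then (1 : ℝ) else 0))) z ∂P :=
        lintegral_const_mul' _ _ ENNReal.ofReal_ne_top

/-- **The stub's `LG`-mean is dominated by the `LG`-mean of the short-flight count** (arbitrary profiles,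
`0 ≤ σ < 1/2`, every flow family, horizon, `A` and `N`): `E_LG[W_sf(A)] ≤ (ε/(N+1)) · E_LG[𝟙_good · #short(t_N/A)]`.
Hence U follows from ANY bound `E_LG[𝟙_good · #short(t_N/A)] ≤ δ (N+1)/ε` eventually in `N`; by the pathwise charging
`shortFlightCount_le_chargedSums` and `localGibbsLaw_lintegral_le_evolvedWindowFlux` such a bound is a bound on the
time-summed one-window contact flux of the evolved local Gibbs laws (the open, `LG`-native content of U). [folklore] -/
theorem localGibbsLaw_lintegral_shortFlag_le (a₀ θ₀ : T3 → ℝ) (u₀ : T3 → V3) (hσ : 0 ≤ σ) (hσ2 : σ < 1 / 2)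
    (Φ : (N : ℕ) → Flow σ N) (τ A : ℝ) (N : ℕ) :
    ∫⁻ z, ENNReal.ofReal (hsDiameter σ N / ((N : ℝ) + 1) *
        ∑ i : Fin (N + 1), ∑ n ∈ Finset.range (cnt (Φ N) τ z i),
          (if (past (Φ N) (rs N) z i n).2.2.2 - (past (Φ N) (rs N) z i n).2.1 < tN N / A then (1 : ℝ) else 0))
        ∂(localGibbsLaw σ a₀ u₀ θ₀ N (Φ N)) ≤
      ENNReal.ofReal (hsDiameter σ N / ((N : ℝ) + 1)) *
        ∫⁻ z, (Φ N).good.indicator (fun z => ENNReal.ofReal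
          (collisionPairSum (Torus.geometry (Fin 3)) (hsDiameter σ N) (orbit σ N (Φ N) z) (Icc 0 τ)
            (fun s i j => if s - tN N / A < pairFlightStart σ N (Φ N) z i j s then (1 : ℝ) else 0))) z
          ∂(localGibbsLaw σ a₀ u₀ θ₀ N (Φ N)) := by
  have hε2 : hsDiameter σ N < 1 / 2 := (hsDiameter_le hσ N).trans_lt hσ2
  have hε0 : 0 ≤ hsDiameter σ N := by
    unfold hsDiameter
    positivity
  have hc : 0 ≤ hsDiameter σ N / ((N : ℝ) + 1) := by positivity
  exact lintegral_shortFlag_le_mul_lintegral_shortFlightCount (Φ N) hε2 _ (by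
    rw [localGibbsLaw_eq]
    exact localGibbsMeasure_absolutelyContinuous σ _ _ _ N (Φ N) (Φ N).measure_compl_good) τ (tN N / A) (rs N) hc

end Summit.AtomisticToContinuum.HydrodynamicLimit.Theorems.KickFairRelEquilibriumMesoLine

end
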